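import Mathlib
import Literature.AlgebraicGeometry.Resolution.NodalFormalMorse
import HarnessLib

/-!
# Junction germs are of type `A`: the normal form of a lifted node `X₀X₁ − ϖ·B` over a complete DVR

[OURS · L1 W4.5(b)] Helper for the research stub `stub_elnat_three_nonisolated` / level 0 of the
crux `EquisingularLiftNat` (stmt-ResolutionOfSingularities-20038; route `EquisingularLift`, chain
w45b, CRUX-PLAN v3 §1.6 companion centres) — idea card 7 `junction-unscrewing`
(res-L1-w45b-idea-2, card sha16 c7b4091fabff3d62; `Sketch-L1-idea-2.lean` v5, step (b)
`JunctionNormalForm`). NOT a statement of any manuscript; AI-written kernel lemma of the cell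
`res-hironaka` (weaker than expert review).

**The statement (card 7 (b)).** Let `O` be a principal ideal domain with an irreducible `ϖ`,
complete for the `ϖ`-adic topology (such a ring is local with maximal ideal `(ϖ)`, i.e. a complete
discrete valuation ring — `isUnit_of_not_dvd`). At a junction of an `O`-flat lift of a single-sheet
nodal companion configuration the germ is, inside the `O`-smooth 3-germ `T`, a LIFTED NODE
`X₀X₁ − ϖ·B ∈ O⟦X₀, X₁⟧`. Then there are new parameters `x' ≡ X₀`, `y' ≡ X₁ (mod ϖ)`
(so `(x', y', ϖ) = (X₀, X₁, ϖ)`) and a unit `U ≡ 1 (mod ϖ)` with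

  `U · (X₀X₁ − ϖB) = x'y' − ϖ^(c+1)·u`, `u` a unit (an `A_c` point; `c = 0` = regular), or
  `U · (X₀X₁ − ϖB) = x'y'` (two regular sheets crossing along a section, `A_∞`):

`junction_normalForm` (verbatim the card's signature) and the sharper `exists_junction_normalForm`
(`x' = X₀ + α`, `y' = X₁ + β`, `U = 1 + ε` with `α, β, ε ∈ ϖ·O⟦X⟧` coefficientwise and the
constant `h ∈ ϖO` with `U·(X₀X₁ − ϖB) = x'y' − h`, `h = 0 ∨ h = ϖ^(c+1)·v`, `v ∈ Oˣ`).

**Method.** The power-series identity is the tree's formal Morse lemma for the node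
(`Literature.AlgebraicGeometry.Resolution.DeJong1996.exists_formalMorse_node`, de Jong 1996, 2.23:
successive approximation in the `𝔪`-adic topology, all proved there) applied with `Λ = O`,
`𝔪 = (ϖ)`, `H = ϖ·B`; the dichotomy for the constant `h ∈ (ϖ)` is `WfDvdMonoid.max_power_factor`
(`h = ϖⁿ·v`, `ϖ ∤ v`) together with the locality of `O` (`IsAdicComplete.le_jacobson_bot`:
`1 + ϖa` is a unit, hence every `v ∉ (ϖ)` is a unit since `(ϖ)` is maximal).

Also recorded (section `Unscrew`, any commutative ring): the card's step (c) identities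
`unscrew_relation` (the `A_{c-1}` germ `x'y' = ϖ^c u` in parameters centred on the section
`(x' − ϖ^a, y' − ϖ^(c−a)u)`) and the two blow-up charts `unscrew_chart` / `unscrew_chart'`
(strict transforms `x'η = −ϖ^(c−a)u`, `ξy' = −ϖ^a`: the `A`-index drops by one per section step).

What is NOT here: step (a) (the `𝔪²`-test `JunctionSqMemIff`, filed separately by res-type-076)
and any statement about the quotient ring `O⟦X₀,X₁⟧/(X₀X₁ − ϖB)` or its blow-up (read off from
the identities by the consumer).

References: A. J. de Jong, *Smoothness, semi-stability and alterations*, Publ. Math. IHÉS 83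
(1996), 2.23 [DeJong1996]; Q. Liu, *Algebraic Geometry and Arithmetic Curves* (2002),
Lemma 10.3.20 [Liu2002].
-/

-- single-problem summit: the doubled namespace component `ResolutionOfSingularities` is forced
set_option linter.dupNamespace false

noncomputable section

namespace Summit.ResolutionOfSingularities.ResolutionOfSingularities.Theorems.EquisingularLift.Junction

universe u

section CompleteBase

variable {O : Type u} [CommRing O]

/-- In a ring complete (and separated) for the `(ϖ)`-adic topology, `1 + ϖ·a` is a unit for every
`a` (geometric series; Mathlib's `IsAdicComplete.le_jacobson_bot`). [folklore] -/
theorem isUnit_one_add_mul_of_isAdicComplete (ϖ : O) [IsAdicComplete (Ideal.span {ϖ}) O]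
    (a : O) : IsUnit (1 + ϖ * a) := by
  have h := IsAdicComplete.le_jacobson_bot (I := Ideal.span {ϖ})
    (Ideal.mem_span_singleton_self ϖ)
  rw [Ideal.mem_jacobson_bot] at h
  rw [add_comm]
  exact h a

/-- **A `ϖ`-adically complete principal ideal ring with `ϖ` irreducible is local with maximal
ideal `(ϖ)`:** every element not divisible by `ϖ` is a unit. (`(ϖ)` is maximal, so `v ∉ (ϖ)`
gives `y·v + ϖ·a = 1`, and `1 − ϖa` is a unit by completeness.) [folklore] -/
theorem isUnit_of_not_dvd [IsPrincipalIdealRing O] {ϖ : O} (hϖ : Irreducible ϖ)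
    [IsAdicComplete (Ideal.span {ϖ}) O] {v : O} (hv : ¬ ϖ ∣ v) : IsUnit v := by
  have hmax := PrincipalIdealRing.isMaximal_of_irreducible hϖ
  have hv' : v ∉ Ideal.span {ϖ} := fun h => hv (Ideal.mem_span_singleton.mp h)
  obtain ⟨y, i, hi, e⟩ := hmax.exists_inv hv'
  obtain ⟨a, rfl⟩ := Ideal.mem_span_singleton.mp hi
  have hu : IsUnit (y * v) := by
    have hyv : y * v = 1 + ϖ * (-a) := by linear_combination e
    rw [hyv]
    exact isUnit_one_add_mul_of_isAdicComplete ϖ (-a)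
  exact isUnit_of_mul_isUnit_right hu

/-- **Elements of `(ϖ)` in a complete DVR-like base are `0` or `ϖ^(c+1)·(unit)`.** For `O` a
principal ideal domain, `ϖ` irreducible, `O` complete for `(ϖ)`: if `ϖ ∣ h` then `h = 0` or
`h = ϖ^(c+1)·v` with `v` a unit (`WfDvdMonoid.max_power_factor` and `isUnit_of_not_dvd`).
[folklore] -/
theorem eq_zero_or_eq_pow_succ_mul_unit [IsDomain O] [IsPrincipalIdealRing O] {ϖ : O}
    (hϖ : Irreducible ϖ) [IsAdicComplete (Ideal.span {ϖ}) O] {h : O} (hh : ϖ ∣ h) :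
    h = 0 ∨ ∃ (c : ℕ) (v : O), IsUnit v ∧ h = ϖ ^ (c + 1) * v := by
  rcases eq_or_ne h 0 with rfl | hne
  · exact Or.inl rfl
  right
  obtain ⟨n, v, hv, rfl⟩ := WfDvdMonoid.max_power_factor hne hϖ
  have hn : n ≠ 0 := by
    rintro rfl
    exact hv (by simpa using hh)
  obtain ⟨c, rfl⟩ := Nat.exists_eq_succ_of_ne_zero hn
  exact ⟨c, v, isUnit_of_not_dvd hϖ hv, rfl⟩

/-- A power series all of whose coefficients are divisible by `ϖ` is `C ϖ` times a power series
(choose the quotients coefficientwise). [folklore] -/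
theorem exists_eq_C_mul_of_forall_dvd {σ : Type*} (ϖ : O) {F : MvPowerSeries σ O}
    (hF : ∀ d, ϖ ∣ MvPowerSeries.coeff d F) :
    ∃ G : MvPowerSeries σ O, F = MvPowerSeries.C ϖ * G := by
  choose g hg using hF
  refine ⟨fun d => g d, ?_⟩
  ext d
  rw [MvPowerSeries.coeff_C_mul, MvPowerSeries.coeff_apply (fun d => g d) d]
  exact hg d

/-- A power series over a `(ϖ)`-adically complete ring whose constant coefficient is `≡ 1 (mod ϖ)`
— here `1 + ε` with all coefficients of `ε` in `(ϖ)` — is a unit. [folklore] -/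
theorem isUnit_one_add_of_forall_dvd {σ : Type*} (ϖ : O) [IsAdicComplete (Ideal.span {ϖ}) O]
    {ε : MvPowerSeries σ O} (hε : ∀ d, ϖ ∣ MvPowerSeries.coeff d ε) :
    IsUnit (1 + ε) := by
  rw [MvPowerSeries.isUnit_iff_constantCoeff, map_add, map_one]
  obtain ⟨a, ha⟩ := hε 0
  rw [MvPowerSeries.coeff_zero_eq_constantCoeff_apply] at ha
  rw [ha]
  exact isUnit_one_add_mul_of_isAdicComplete ϖ a

/-- **Normal form of a lifted node, sharp version.** `O` a principal ideal domain, `ϖ`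
irreducible, `O` complete for `(ϖ)`; `B ∈ O⟦X₀, X₁⟧` arbitrary. Then there are power series
`α, β, ε` with all coefficients in `(ϖ)` and a constant `h ∈ (ϖ)` such that `1 + ε` is a unit,

  `(1 + ε) · (X₀X₁ − ϖ·B) = (X₀ + α)(X₁ + β) − h`,

and `h = 0` or `h = ϖ^(c+1)·v` with `v` a unit of `O`. The identity is the tree's formal Morse
lemma `DeJong1996.exists_formalMorse_node` with `𝔪 = (ϖ)`, `H = ϖB`; the dichotomy is
`eq_zero_or_eq_pow_succ_mul_unit`. [OURS · L1 W4.5(b), card 7 `junction-unscrewing` (b)] -/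
theorem exists_junction_normalForm [IsDomain O] [IsPrincipalIdealRing O] {ϖ : O}
    (hϖ : Irreducible ϖ) [IsAdicComplete (Ideal.span {ϖ}) O] (B : MvPowerSeries (Fin 2) O) :
    ∃ (α β ε : MvPowerSeries (Fin 2) O) (h : O),
      (∀ d, ϖ ∣ MvPowerSeries.coeff d α) ∧ (∀ d, ϖ ∣ MvPowerSeries.coeff d β) ∧
      (∀ d, ϖ ∣ MvPowerSeries.coeff d ε) ∧ ϖ ∣ h ∧ IsUnit (1 + ε) ∧
      (1 + ε) * (MvPowerSeries.X 0 * MvPowerSeries.X 1 - MvPowerSeries.C ϖ * B) =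
        (MvPowerSeries.X 0 + α) * (MvPowerSeries.X 1 + β) - MvPowerSeries.C h ∧
      (h = 0 ∨ ∃ (c : ℕ) (v : O), IsUnit v ∧ h = ϖ ^ (c + 1) * v) := by
  obtain ⟨α, β, ε, h, hα, hβ, hε, hh, e⟩ :=
    Literature.AlgebraicGeometry.Resolution.DeJong1996.exists_formalMorse_node (Ideal.span {ϖ})
      (MvPowerSeries.C ϖ * B) (fun d => by
        rw [MvPowerSeries.coeff_C_mul]
        exact Ideal.mul_mem_right _ _ (Ideal.mem_span_singleton_self ϖ))
  simp only [Ideal.mem_span_singleton] at hα hβ hε hh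
  exact ⟨α, β, ε, h, hα, hβ, hε, hh, isUnit_one_add_of_forall_dvd ϖ hε, e,
    eq_zero_or_eq_pow_succ_mul_unit hϖ hh⟩

end CompleteBase

/-- **Card 7, step (b): junction germs are of type `A` (`JunctionNormalForm`, verbatim the
signature of `Sketch-L1-idea-2.lean` v5).** Over a complete DVR `O` (= a principal ideal domain
with an irreducible `ϖ`, complete for the `ϖ`-adic topology), every lifted node `X₀X₁ − ϖ·B` in
`O⟦X₀, X₁⟧` becomes, after a change of the two parameters by multiples of `ϖ` and multiplication
by a unit, either `x'y' − ϖ^(c+1)·u` with `u` a unit (an `A_c` point, `c ≥ 0`; `c = 0` = regular)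
or `x'y'` (two regular sheets crossing along a section). From `exists_junction_normalForm` with
`x' = X₀ + ϖα'`, `y' = X₁ + ϖβ'`, `U = 1 + ε`, `u = C v`.
[OURS · L1 W4.5(b), card 7 `junction-unscrewing` (b); NOT a statement of the manuscript] -/
theorem junction_normalForm :
    ∀ (O : Type) [CommRing O] [IsDomain O] [IsPrincipalIdealRing O] (ϖ : O), Irreducible ϖ →
      IsAdicComplete (Ideal.span {ϖ}) O →
      ∀ B : MvPowerSeries (Fin 2) O,
        ∃ (x' y' U : MvPowerSeries (Fin 2) O), IsUnit U ∧
          Ideal.span {x', y', MvPowerSeries.C ϖ} =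
            Ideal.span {(MvPowerSeries.X 0 : MvPowerSeries (Fin 2) O), MvPowerSeries.X 1,
              MvPowerSeries.C ϖ} ∧
          ((∃ (c : ℕ) (u : MvPowerSeries (Fin 2) O), IsUnit u ∧
              U * (MvPowerSeries.X 0 * MvPowerSeries.X 1 - MvPowerSeries.C ϖ * B) =
                x' * y' - MvPowerSeries.C (ϖ ^ (c + 1)) * u) ∨
            U * (MvPowerSeries.X 0 * MvPowerSeries.X 1 - MvPowerSeries.C ϖ * B) = x' * y') := by
  intro O _ _ _ ϖ hϖ hO B
  obtain ⟨α, β, ε, h, hα, hβ, _hε, _hh, hU, e, hdich⟩ := exists_junction_normalForm hϖ B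
  obtain ⟨α', rfl⟩ := exists_eq_C_mul_of_forall_dvd ϖ hα
  obtain ⟨β', rfl⟩ := exists_eq_C_mul_of_forall_dvd ϖ hβ
  -- membership of the generators in the two spans
  have hX0 : (MvPowerSeries.X 0 : MvPowerSeries (Fin 2) O) ∈
      Ideal.span {(MvPowerSeries.X 0 : MvPowerSeries (Fin 2) O), MvPowerSeries.X 1,
        MvPowerSeries.C ϖ} := Ideal.subset_span (by simp)
  have hX1 : (MvPowerSeries.X 1 : MvPowerSeries (Fin 2) O) ∈
      Ideal.span {(MvPowerSeries.X 0 : MvPowerSeries (Fin 2) O), MvPowerSeries.X 1,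
        MvPowerSeries.C ϖ} := Ideal.subset_span (by simp)
  have hC : (MvPowerSeries.C ϖ : MvPowerSeries (Fin 2) O) ∈
      Ideal.span {(MvPowerSeries.X 0 : MvPowerSeries (Fin 2) O), MvPowerSeries.X 1,
        MvPowerSeries.C ϖ} := Ideal.subset_span (by simp)
  have hx' : MvPowerSeries.X 0 + MvPowerSeries.C ϖ * α' ∈
      Ideal.span {MvPowerSeries.X 0 + MvPowerSeries.C ϖ * α', MvPowerSeries.X 1 +
        MvPowerSeries.C ϖ * β', (MvPowerSeries.C ϖ : MvPowerSeries (Fin 2) O)} :=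
    Ideal.subset_span (by simp)
  have hy' : MvPowerSeries.X 1 + MvPowerSeries.C ϖ * β' ∈
      Ideal.span {MvPowerSeries.X 0 + MvPowerSeries.C ϖ * α', MvPowerSeries.X 1 +
        MvPowerSeries.C ϖ * β', (MvPowerSeries.C ϖ : MvPowerSeries (Fin 2) O)} :=
    Ideal.subset_span (by simp)
  have hC' : (MvPowerSeries.C ϖ : MvPowerSeries (Fin 2) O) ∈
      Ideal.span {MvPowerSeries.X 0 + MvPowerSeries.C ϖ * α', MvPowerSeries.X 1 +
        MvPowerSeries.C ϖ * β', (MvPowerSeries.C ϖ : MvPowerSeries (Fin 2) O)} :=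
    Ideal.subset_span (by simp)
  refine ⟨MvPowerSeries.X 0 + MvPowerSeries.C ϖ * α', MvPowerSeries.X 1 + MvPowerSeries.C ϖ * β',
    1 + ε, hU, ?_, ?_⟩
  · apply le_antisymm
    · rw [Ideal.span_le]
      rintro z hz
      simp only [Set.mem_insert_iff, Set.mem_singleton_iff] at hz
      rcases hz with rfl | rfl | rfl
      · exact Ideal.add_mem _ hX0 (Ideal.mul_mem_right _ _ hC)
      · exact Ideal.add_mem _ hX1 (Ideal.mul_mem_right _ _ hC)
      · exact hC
    · rw [Ideal.span_le]
      rintro z hz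
      simp only [Set.mem_insert_iff, Set.mem_singleton_iff] at hz
      rcases hz with rfl | rfl | rfl
      · have hz := Ideal.sub_mem _ hx' (Ideal.mul_mem_right α' _ hC')
        rwa [add_sub_cancel_right] at hz
      · have hz := Ideal.sub_mem _ hy' (Ideal.mul_mem_right β' _ hC')
        rwa [add_sub_cancel_right] at hz
      · exact hC'
  · rcases hdich with rfl | ⟨c, v, hv, rfl⟩
    · right
      rw [e, map_zero, sub_zero]
    · left
      refine ⟨c, MvPowerSeries.C v, hv.map _, ?_⟩
      rw [e, map_mul]

section Unscrew

variable {R : Type u} [CommRing R]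

/-- **Card 7, step (c): the unscrewing relation.** If `x'·y' = ϖ^c·u` and `a ≤ c`, then with
`X = x' − ϖ^a`, `Y = y' − ϖ^(c−a)·u` one has `X·Y + ϖ^(c−a)·u·X + ϖ^a·Y = 0` — the equation of the
junction germ of type `A_{c-1}` in parameters centred on the SECTION `(X, Y)` (which lies on the
companion centre since `x'y' − ϖ^c u ∈ (X, Y)`). Verbatim the signature `UnscrewRelation` of
`Sketch-L1-idea-2.lean` v5 (proved there; recorded here next to (b) so that card 7 (b)+(c) is
citable from the tree). [OURS · L1 W4.5(b), card 7 `junction-unscrewing` (c)] -/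
theorem unscrew_relation (ϖ u x' y' : R) (a c : ℕ) (hac : a ≤ c) (h : x' * y' = ϖ ^ c * u) :
    (x' - ϖ ^ a) * (y' - ϖ ^ (c - a) * u) + ϖ ^ (c - a) * u * (x' - ϖ ^ a) +
      ϖ ^ a * (y' - ϖ ^ (c - a) * u) = 0 := by
  have hc : ϖ ^ c = ϖ ^ a * ϖ ^ (c - a) := by rw [← pow_add, Nat.add_sub_cancel' hac]
  rw [hc] at h
  linear_combination h

/-- **Card 7, step (c′): one chart of the section blow-up.** Substituting `Y = X·η` (a chart of
the blow-up of the section ideal `(X, Y)`) into the unscrewing relation factors off the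
exceptional divisor `X = 0`; the strict transform is `η·(X + ϖ^a) + ϖ^(c−a)·u = 0`, i.e.
`x'·η = −ϖ^(c−a)·u` — a junction of type `A_{c−a−1}` (regular iff `a = c − 1`); the other chart is
symmetric (`ξ·y' = −ϖ^a`, type `A_{a−1}`), so the total `A`-index drops by exactly one per section
step. Verbatim the signature `UnscrewChart` of `Sketch-L1-idea-2.lean` v5.
[OURS · L1 W4.5(b), card 7 `junction-unscrewing` (c′)] -/
theorem unscrew_chart (ϖ u X η : R) (a c : ℕ) :
    X * (X * η) + ϖ ^ (c - a) * u * X + ϖ ^ a * (X * η) =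
      X * (η * (X + ϖ ^ a) + ϖ ^ (c - a) * u) := by
  ring

/-- The other chart `X = ξ·Y` of the same blow-up: the strict transform is
`ξ·(Y + ϖ^(c−a)·u) + ϖ^a = 0`, i.e. `ξ·y' = −ϖ^a` (type `A_{a−1}`). [OURS · L1 W4.5(b), card 7 (c′)] -/
theorem unscrew_chart' (ϖ u ξ Y : R) (a c : ℕ) :
    ξ * Y * Y + ϖ ^ (c - a) * u * (ξ * Y) + ϖ ^ a * Y =
      Y * (ξ * (Y + ϖ ^ (c - a) * u) + ϖ ^ a) := by
  ring

end Unscrew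

end Summit.ResolutionOfSingularities.ResolutionOfSingularities.Theorems.EquisingularLift.Junction

end
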